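import Summits.QuantumFields.YangMills.Theorems.FluctuationComparisonRegPrIntLOrganTangentHClauseAlgebra
import HarnessLib

/-!
# THE `HClauseSq` ALGEBRA (2∕2) — the bundled `∃ k`-BLOCK (tool brick «KIT» of LEAD-20520 w3 g25 №3, companion of `…OrganTangentHClauseAlgebra`)

Cell `ym3-torus` (YM ladder rung R3 = continuum `SU(2)` Yang–Mills on the three-torus — a RUNG: NOT d = 4, NOT infinite volume, NOT a mass
gap, NOT Clay).  Seat `ym-line-cst-p1` g41 (FREE hand; brick «KIT» named by LEAD w3 g25 №3, 2026-08-31); crux `stmt-QuantumFields-20520`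
(`…Theses.UnitScaleTilt.FluctuationComparisonRegPrIntL`), organ-tangent lane; `--kind proof --supports stmt-QuantumFields-20520 --as helper`:
count-neutral, DEFINITION-FREE (0 `def`, 0 `instance`, 0 `notation`, 0 `sorry`, default heartbeats), no registry ∕ binder ∕ `Lines/` byte.

WHAT.  The inner `∃ k`-BLOCK of the conclusions of O1ᵘ-H v2 ∕ LINᵘ-H ∕ JENᵘ-H (BRICK 1 ✓`OrganTangentTaylorCutH`, px19 `hO` de4191aa1ceaec5a):

  `∃ k : PBond P j → PBond P j → ℝ, (∀ b b', 0 ≤ k b b') ∧ (∀ b, Σ_{b'} k b b'·e^{κ·tdist(b.src,b'.src)} ≤ w) ∧ ⟨HClauseSq θ r k R, written out⟩`,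

for ABSTRACT `R R₁ R₂ : GaugeField P j SU(2) → ℝ`: `block_add` (`(w₁,R₁)`, `(w₂,R₂)` ↦ `(w₁+w₂, R₁+R₂)` — BRICK 1's junction step by name),
`block_smul` (`(|c|·w, c·R)`), `block_neg`, `block_sub`, `block_cap_mono` (`r' ≤ r`), `block_window` (`0 < θ' ≤ θ`, `r'θ' ≤ rθ`: letters
`(θ'∕θ)²·k`, row mass `(θ'∕θ)²·w`), `block_rate_mono` (`κ' ≤ κ`, ✓px19 Core `rowMass_mono` by name), `block_weight_mono`, `block_const`.  Each is
one line over the companion's (K1)–(K6) (`hClauseSq_add`∕`_smul`∕`_neg`∕`_sub`∕`_cap_mono`∕`_window`∕`_const`, `rowMass_add_le`∕`_abs_smul_le`∕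
`_window_le`∕`_zero_le`).  [folklore]

HONEST.  Bookkeeping only; nothing of Bałaban's is asserted or proved; LINᵘ-H, JENᵘ-H, O1ᵘ-H v2 (XL), S1aᴴ, S2β's five registered stubs, crux 20520
and the leaf `YM3TorusSU2` are NOT proved; rung R3 = SU(2) YM₃ on T³ at fixed lattice data — NOT d = 4, NOT infinite volume, NOT a mass gap, NOT Clay;
the Yang–Mills mass gap is NOT proved.  Sorry-free, axioms standard.
-/

set_option autoImplicit false

noncomputable section

open MeasureTheory
open Literature.MathematicalPhysics.QuantumFieldTheory.Balaban1983to89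
open T4CubeChartExp (expPt)
open Summit.QuantumFields.YangMills.Theorems.OrganTangentJunctionDirectTransportCore (rowMass_mono)
open Summit.QuantumFields.YangMills.Theorems.OrganTangentHClauseAlgebra
open scoped BigOperators

namespace Summit.QuantumFields.YangMills.Theorems.OrganTangentHClauseBlock

variable {P : Params} {j : ℕ}

/-! ## §3 The bundled `∃ k`-block: `∃ k, (∀ b b', 0 ≤ k b b') ∧ ⟨row-mass ≤ w⟩ ∧ ⟨clause θ r k R⟩` -/

section Block

variable {θ r κ w w₁ w₂ : ℝ} {R R₁ R₂ : GaugeField P j (Matrix.specialUnitaryGroup (Fin 2) ℂ) → ℝ}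

/-- (BLOCK) **ADDITIVITY** of the `∃ k`-block: blocks for `(w₁, R₁)` and `(w₂, R₂)` give the block for `(w₁ + w₂, R₁ + R₂)` — the junction step of
BRICK 1 ✓`oneStepTransportUH_of_tangentH_jensenH`, by name. [folklore] -/
theorem block_add
    (h₁ : ∃ k : PBond P j → PBond P j → ℝ, (∀ b b', 0 ≤ k b b') ∧ (∀ b, ∑ b', k b b' * Real.exp (κ * (b.src.tdist b'.src : ℝ)) ≤ w₁) ∧
      ∀ (b b' : PBond P j) (v v' : Fin 3 → ℝ) (U V W Z : GaugeField P j (Matrix.specialUnitaryGroup (Fin 2) ℂ)),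
        ‖v‖ ≤ r * θ → ‖v'‖ ≤ r * θ → PlaqSmall θ U → PlaqSmall θ V → PlaqSmall θ W → PlaqSmall θ Z →
        (∀ e, e ≠ b → V e = U e) → V b = U b * expPt v → (∀ e, e ≠ b' → W e = U e) → W b' = U b' * expPt v' →
        (∀ e, e ≠ b' → Z e = V e) → Z b' = V b' * expPt v' →
        |R₁ Z - R₁ V - R₁ W + R₁ U| ≤ k b b' * (‖v‖ / θ) * (‖v'‖ / θ))
    (h₂ : ∃ k : PBond P j → PBond P j → ℝ, (∀ b b', 0 ≤ k b b') ∧ (∀ b, ∑ b', k b b' * Real.exp (κ * (b.src.tdist b'.src : ℝ)) ≤ w₂) ∧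
      ∀ (b b' : PBond P j) (v v' : Fin 3 → ℝ) (U V W Z : GaugeField P j (Matrix.specialUnitaryGroup (Fin 2) ℂ)),
        ‖v‖ ≤ r * θ → ‖v'‖ ≤ r * θ → PlaqSmall θ U → PlaqSmall θ V → PlaqSmall θ W → PlaqSmall θ Z →
        (∀ e, e ≠ b → V e = U e) → V b = U b * expPt v → (∀ e, e ≠ b' → W e = U e) → W b' = U b' * expPt v' →
        (∀ e, e ≠ b' → Z e = V e) → Z b' = V b' * expPt v' →
        |R₂ Z - R₂ V - R₂ W + R₂ U| ≤ k b b' * (‖v‖ / θ) * (‖v'‖ / θ)) :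
    ∃ k : PBond P j → PBond P j → ℝ, (∀ b b', 0 ≤ k b b') ∧ (∀ b, ∑ b', k b b' * Real.exp (κ * (b.src.tdist b'.src : ℝ)) ≤ w₁ + w₂) ∧
      ∀ (b b' : PBond P j) (v v' : Fin 3 → ℝ) (U V W Z : GaugeField P j (Matrix.specialUnitaryGroup (Fin 2) ℂ)),
        ‖v‖ ≤ r * θ → ‖v'‖ ≤ r * θ → PlaqSmall θ U → PlaqSmall θ V → PlaqSmall θ W → PlaqSmall θ Z →
        (∀ e, e ≠ b → V e = U e) → V b = U b * expPt v → (∀ e, e ≠ b' → W e = U e) → W b' = U b' * expPt v' →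
        (∀ e, e ≠ b' → Z e = V e) → Z b' = V b' * expPt v' →
        |(R₁ Z + R₂ Z) - (R₁ V + R₂ V) - (R₁ W + R₂ W) + (R₁ U + R₂ U)| ≤ k b b' * (‖v‖ / θ) * (‖v'‖ / θ) := by
  obtain ⟨k₁, hk₁, hr₁, hc₁⟩ := h₁
  obtain ⟨k₂, hk₂, hr₂, hc₂⟩ := h₂
  exact ⟨fun b b' => k₁ b b' + k₂ b b', fun b b' => add_nonneg (hk₁ b b') (hk₂ b b'), rowMass_add_le hr₁ hr₂, hClauseSq_add hc₁ hc₂⟩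

/-- (BLOCK) **SCALARS**: the block for `(w, R)` gives the block for `(|c|·w, c·R)`. [folklore] -/
theorem block_smul (c : ℝ)
    (h : ∃ k : PBond P j → PBond P j → ℝ, (∀ b b', 0 ≤ k b b') ∧ (∀ b, ∑ b', k b b' * Real.exp (κ * (b.src.tdist b'.src : ℝ)) ≤ w) ∧
      ∀ (b b' : PBond P j) (v v' : Fin 3 → ℝ) (U V W Z : GaugeField P j (Matrix.specialUnitaryGroup (Fin 2) ℂ)),
        ‖v‖ ≤ r * θ → ‖v'‖ ≤ r * θ → PlaqSmall θ U → PlaqSmall θ V → PlaqSmall θ W → PlaqSmall θ Z →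
        (∀ e, e ≠ b → V e = U e) → V b = U b * expPt v → (∀ e, e ≠ b' → W e = U e) → W b' = U b' * expPt v' →
        (∀ e, e ≠ b' → Z e = V e) → Z b' = V b' * expPt v' →
        |R Z - R V - R W + R U| ≤ k b b' * (‖v‖ / θ) * (‖v'‖ / θ)) :
    ∃ k : PBond P j → PBond P j → ℝ, (∀ b b', 0 ≤ k b b') ∧ (∀ b, ∑ b', k b b' * Real.exp (κ * (b.src.tdist b'.src : ℝ)) ≤ |c| * w) ∧
      ∀ (b b' : PBond P j) (v v' : Fin 3 → ℝ) (U V W Z : GaugeField P j (Matrix.specialUnitaryGroup (Fin 2) ℂ)),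
        ‖v‖ ≤ r * θ → ‖v'‖ ≤ r * θ → PlaqSmall θ U → PlaqSmall θ V → PlaqSmall θ W → PlaqSmall θ Z →
        (∀ e, e ≠ b → V e = U e) → V b = U b * expPt v → (∀ e, e ≠ b' → W e = U e) → W b' = U b' * expPt v' →
        (∀ e, e ≠ b' → Z e = V e) → Z b' = V b' * expPt v' →
        |c * R Z - c * R V - c * R W + c * R U| ≤ k b b' * (‖v‖ / θ) * (‖v'‖ / θ) := by
  obtain ⟨k, hk, hr, hc⟩ := h
  exact ⟨fun b b' => |c| * k b b', fun b b' => mul_nonneg (abs_nonneg c) (hk b b'), rowMass_abs_smul_le c hr, hClauseSq_smul c hc⟩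

/-- (BLOCK) **NEGATION**: the block for `(w, R)` gives the block for `(w, −R)`. [folklore] -/
theorem block_neg
    (h : ∃ k : PBond P j → PBond P j → ℝ, (∀ b b', 0 ≤ k b b') ∧ (∀ b, ∑ b', k b b' * Real.exp (κ * (b.src.tdist b'.src : ℝ)) ≤ w) ∧
      ∀ (b b' : PBond P j) (v v' : Fin 3 → ℝ) (U V W Z : GaugeField P j (Matrix.specialUnitaryGroup (Fin 2) ℂ)),
        ‖v‖ ≤ r * θ → ‖v'‖ ≤ r * θ → PlaqSmall θ U → PlaqSmall θ V → PlaqSmall θ W → PlaqSmall θ Z →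
        (∀ e, e ≠ b → V e = U e) → V b = U b * expPt v → (∀ e, e ≠ b' → W e = U e) → W b' = U b' * expPt v' →
        (∀ e, e ≠ b' → Z e = V e) → Z b' = V b' * expPt v' →
        |R Z - R V - R W + R U| ≤ k b b' * (‖v‖ / θ) * (‖v'‖ / θ)) :
    ∃ k : PBond P j → PBond P j → ℝ, (∀ b b', 0 ≤ k b b') ∧ (∀ b, ∑ b', k b b' * Real.exp (κ * (b.src.tdist b'.src : ℝ)) ≤ w) ∧
      ∀ (b b' : PBond P j) (v v' : Fin 3 → ℝ) (U V W Z : GaugeField P j (Matrix.specialUnitaryGroup (Fin 2) ℂ)),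
        ‖v‖ ≤ r * θ → ‖v'‖ ≤ r * θ → PlaqSmall θ U → PlaqSmall θ V → PlaqSmall θ W → PlaqSmall θ Z →
        (∀ e, e ≠ b → V e = U e) → V b = U b * expPt v → (∀ e, e ≠ b' → W e = U e) → W b' = U b' * expPt v' →
        (∀ e, e ≠ b' → Z e = V e) → Z b' = V b' * expPt v' →
        |(-R Z) - (-R V) - (-R W) + (-R U)| ≤ k b b' * (‖v‖ / θ) * (‖v'‖ / θ) := by
  obtain ⟨k, hk, hr, hc⟩ := h
  exact ⟨k, hk, hr, hClauseSq_neg hc⟩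

/-- (BLOCK) **SUBTRACTION**: blocks for `(w₁, R₁)` and `(w₂, R₂)` give the block for `(w₁ + w₂, R₁ − R₂)`. [folklore] -/
theorem block_sub
    (h₁ : ∃ k : PBond P j → PBond P j → ℝ, (∀ b b', 0 ≤ k b b') ∧ (∀ b, ∑ b', k b b' * Real.exp (κ * (b.src.tdist b'.src : ℝ)) ≤ w₁) ∧
      ∀ (b b' : PBond P j) (v v' : Fin 3 → ℝ) (U V W Z : GaugeField P j (Matrix.specialUnitaryGroup (Fin 2) ℂ)),
        ‖v‖ ≤ r * θ → ‖v'‖ ≤ r * θ → PlaqSmall θ U → PlaqSmall θ V → PlaqSmall θ W → PlaqSmall θ Z →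
        (∀ e, e ≠ b → V e = U e) → V b = U b * expPt v → (∀ e, e ≠ b' → W e = U e) → W b' = U b' * expPt v' →
        (∀ e, e ≠ b' → Z e = V e) → Z b' = V b' * expPt v' →
        |R₁ Z - R₁ V - R₁ W + R₁ U| ≤ k b b' * (‖v‖ / θ) * (‖v'‖ / θ))
    (h₂ : ∃ k : PBond P j → PBond P j → ℝ, (∀ b b', 0 ≤ k b b') ∧ (∀ b, ∑ b', k b b' * Real.exp (κ * (b.src.tdist b'.src : ℝ)) ≤ w₂) ∧
      ∀ (b b' : PBond P j) (v v' : Fin 3 → ℝ) (U V W Z : GaugeField P j (Matrix.specialUnitaryGroup (Fin 2) ℂ)),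
        ‖v‖ ≤ r * θ → ‖v'‖ ≤ r * θ → PlaqSmall θ U → PlaqSmall θ V → PlaqSmall θ W → PlaqSmall θ Z →
        (∀ e, e ≠ b → V e = U e) → V b = U b * expPt v → (∀ e, e ≠ b' → W e = U e) → W b' = U b' * expPt v' →
        (∀ e, e ≠ b' → Z e = V e) → Z b' = V b' * expPt v' →
        |R₂ Z - R₂ V - R₂ W + R₂ U| ≤ k b b' * (‖v‖ / θ) * (‖v'‖ / θ)) :
    ∃ k : PBond P j → PBond P j → ℝ, (∀ b b', 0 ≤ k b b') ∧ (∀ b, ∑ b', k b b' * Real.exp (κ * (b.src.tdist b'.src : ℝ)) ≤ w₁ + w₂) ∧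
      ∀ (b b' : PBond P j) (v v' : Fin 3 → ℝ) (U V W Z : GaugeField P j (Matrix.specialUnitaryGroup (Fin 2) ℂ)),
        ‖v‖ ≤ r * θ → ‖v'‖ ≤ r * θ → PlaqSmall θ U → PlaqSmall θ V → PlaqSmall θ W → PlaqSmall θ Z →
        (∀ e, e ≠ b → V e = U e) → V b = U b * expPt v → (∀ e, e ≠ b' → W e = U e) → W b' = U b' * expPt v' →
        (∀ e, e ≠ b' → Z e = V e) → Z b' = V b' * expPt v' →
        |(R₁ Z - R₂ Z) - (R₁ V - R₂ V) - (R₁ W - R₂ W) + (R₁ U - R₂ U)| ≤ k b b' * (‖v‖ / θ) * (‖v'‖ / θ) := by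
  obtain ⟨k₁, hk₁, hr₁, hc₁⟩ := h₁
  obtain ⟨k₂, hk₂, hr₂, hc₂⟩ := h₂
  exact ⟨fun b b' => k₁ b b' + k₂ b b', fun b b' => add_nonneg (hk₁ b b') (hk₂ b b'), rowMass_add_le hr₁ hr₂, hClauseSq_sub hc₁ hc₂⟩

/-- (BLOCK) **THE CAP IS ANTITONE** (`0 ≤ θ`, `r' ≤ r`): same letters, same row mass. [folklore] -/
theorem block_cap_mono {r' : ℝ} (hθ : 0 ≤ θ) (hr : r' ≤ r)
    (h : ∃ k : PBond P j → PBond P j → ℝ, (∀ b b', 0 ≤ k b b') ∧ (∀ b, ∑ b', k b b' * Real.exp (κ * (b.src.tdist b'.src : ℝ)) ≤ w) ∧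
      ∀ (b b' : PBond P j) (v v' : Fin 3 → ℝ) (U V W Z : GaugeField P j (Matrix.specialUnitaryGroup (Fin 2) ℂ)),
        ‖v‖ ≤ r * θ → ‖v'‖ ≤ r * θ → PlaqSmall θ U → PlaqSmall θ V → PlaqSmall θ W → PlaqSmall θ Z →
        (∀ e, e ≠ b → V e = U e) → V b = U b * expPt v → (∀ e, e ≠ b' → W e = U e) → W b' = U b' * expPt v' →
        (∀ e, e ≠ b' → Z e = V e) → Z b' = V b' * expPt v' →
        |R Z - R V - R W + R U| ≤ k b b' * (‖v‖ / θ) * (‖v'‖ / θ)) :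
    ∃ k : PBond P j → PBond P j → ℝ, (∀ b b', 0 ≤ k b b') ∧ (∀ b, ∑ b', k b b' * Real.exp (κ * (b.src.tdist b'.src : ℝ)) ≤ w) ∧
      ∀ (b b' : PBond P j) (v v' : Fin 3 → ℝ) (U V W Z : GaugeField P j (Matrix.specialUnitaryGroup (Fin 2) ℂ)),
        ‖v‖ ≤ r' * θ → ‖v'‖ ≤ r' * θ → PlaqSmall θ U → PlaqSmall θ V → PlaqSmall θ W → PlaqSmall θ Z →
        (∀ e, e ≠ b → V e = U e) → V b = U b * expPt v → (∀ e, e ≠ b' → W e = U e) → W b' = U b' * expPt v' →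
        (∀ e, e ≠ b' → Z e = V e) → Z b' = V b' * expPt v' →
        |R Z - R V - R W + R U| ≤ k b b' * (‖v‖ / θ) * (‖v'‖ / θ) := by
  obtain ⟨k, hk, hr', hc⟩ := h
  exact ⟨k, hk, hr', hClauseSq_cap_mono hθ hr hc⟩

/-- (BLOCK) **WINDOW ∕ SCALE CHANGE** (`0 < θ' ≤ θ`, `r'·θ' ≤ r·θ`): letters `(θ'∕θ)²·k`, row mass `(θ'∕θ)²·w`. [folklore] -/
theorem block_window {θ' r' : ℝ} (hθ' : 0 < θ') (hθθ : θ' ≤ θ) (hrr : r' * θ' ≤ r * θ)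
    (h : ∃ k : PBond P j → PBond P j → ℝ, (∀ b b', 0 ≤ k b b') ∧ (∀ b, ∑ b', k b b' * Real.exp (κ * (b.src.tdist b'.src : ℝ)) ≤ w) ∧
      ∀ (b b' : PBond P j) (v v' : Fin 3 → ℝ) (U V W Z : GaugeField P j (Matrix.specialUnitaryGroup (Fin 2) ℂ)),
        ‖v‖ ≤ r * θ → ‖v'‖ ≤ r * θ → PlaqSmall θ U → PlaqSmall θ V → PlaqSmall θ W → PlaqSmall θ Z →
        (∀ e, e ≠ b → V e = U e) → V b = U b * expPt v → (∀ e, e ≠ b' → W e = U e) → W b' = U b' * expPt v' →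
        (∀ e, e ≠ b' → Z e = V e) → Z b' = V b' * expPt v' →
        |R Z - R V - R W + R U| ≤ k b b' * (‖v‖ / θ) * (‖v'‖ / θ)) :
    ∃ k : PBond P j → PBond P j → ℝ, (∀ b b', 0 ≤ k b b') ∧ (∀ b, ∑ b', k b b' * Real.exp (κ * (b.src.tdist b'.src : ℝ)) ≤ (θ' / θ) ^ 2 * w) ∧
      ∀ (b b' : PBond P j) (v v' : Fin 3 → ℝ) (U V W Z : GaugeField P j (Matrix.specialUnitaryGroup (Fin 2) ℂ)),
        ‖v‖ ≤ r' * θ' → ‖v'‖ ≤ r' * θ' → PlaqSmall θ' U → PlaqSmall θ' V → PlaqSmall θ' W → PlaqSmall θ' Z →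
        (∀ e, e ≠ b → V e = U e) → V b = U b * expPt v → (∀ e, e ≠ b' → W e = U e) → W b' = U b' * expPt v' →
        (∀ e, e ≠ b' → Z e = V e) → Z b' = V b' * expPt v' →
        |R Z - R V - R W + R U| ≤ k b b' * (‖v‖ / θ') * (‖v'‖ / θ') := by
  obtain ⟨k, hk, hr', hc⟩ := h
  exact ⟨fun b b' => (θ' / θ) ^ 2 * k b b', fun b b' => mul_nonneg (sq_nonneg _) (hk b b'), rowMass_window_le θ θ' hr',
    hClauseSq_window hθ' hθθ hrr hc⟩

/-- (BLOCK) **RATE MONOTONICITY** (`κ' ≤ κ`): the same letters have row mass `≤ w` at every smaller rate (✓px19 Core `rowMass_mono`, by name). [folklore] -/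
theorem block_rate_mono {κ' : ℝ} (hκ : κ' ≤ κ)
    (h : ∃ k : PBond P j → PBond P j → ℝ, (∀ b b', 0 ≤ k b b') ∧ (∀ b, ∑ b', k b b' * Real.exp (κ * (b.src.tdist b'.src : ℝ)) ≤ w) ∧
      ∀ (b b' : PBond P j) (v v' : Fin 3 → ℝ) (U V W Z : GaugeField P j (Matrix.specialUnitaryGroup (Fin 2) ℂ)),
        ‖v‖ ≤ r * θ → ‖v'‖ ≤ r * θ → PlaqSmall θ U → PlaqSmall θ V → PlaqSmall θ W → PlaqSmall θ Z →
        (∀ e, e ≠ b → V e = U e) → V b = U b * expPt v → (∀ e, e ≠ b' → W e = U e) → W b' = U b' * expPt v' →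
        (∀ e, e ≠ b' → Z e = V e) → Z b' = V b' * expPt v' →
        |R Z - R V - R W + R U| ≤ k b b' * (‖v‖ / θ) * (‖v'‖ / θ)) :
    ∃ k : PBond P j → PBond P j → ℝ, (∀ b b', 0 ≤ k b b') ∧ (∀ b, ∑ b', k b b' * Real.exp (κ' * (b.src.tdist b'.src : ℝ)) ≤ w) ∧
      ∀ (b b' : PBond P j) (v v' : Fin 3 → ℝ) (U V W Z : GaugeField P j (Matrix.specialUnitaryGroup (Fin 2) ℂ)),
        ‖v‖ ≤ r * θ → ‖v'‖ ≤ r * θ → PlaqSmall θ U → PlaqSmall θ V → PlaqSmall θ W → PlaqSmall θ Z →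
        (∀ e, e ≠ b → V e = U e) → V b = U b * expPt v → (∀ e, e ≠ b' → W e = U e) → W b' = U b' * expPt v' →
        (∀ e, e ≠ b' → Z e = V e) → Z b' = V b' * expPt v' →
        |R Z - R V - R W + R U| ≤ k b b' * (‖v‖ / θ) * (‖v'‖ / θ) := by
  obtain ⟨k, hk, hr', hc⟩ := h
  exact ⟨k, hk, fun b => rowMass_mono hκ hk hr' b, hc⟩

/-- (BLOCK) **WEIGHT MONOTONICITY** (`w ≤ w'`). [folklore] -/
theorem block_weight_mono {w' : ℝ} (hw : w ≤ w')
    (h : ∃ k : PBond P j → PBond P j → ℝ, (∀ b b', 0 ≤ k b b') ∧ (∀ b, ∑ b', k b b' * Real.exp (κ * (b.src.tdist b'.src : ℝ)) ≤ w) ∧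
      ∀ (b b' : PBond P j) (v v' : Fin 3 → ℝ) (U V W Z : GaugeField P j (Matrix.specialUnitaryGroup (Fin 2) ℂ)),
        ‖v‖ ≤ r * θ → ‖v'‖ ≤ r * θ → PlaqSmall θ U → PlaqSmall θ V → PlaqSmall θ W → PlaqSmall θ Z →
        (∀ e, e ≠ b → V e = U e) → V b = U b * expPt v → (∀ e, e ≠ b' → W e = U e) → W b' = U b' * expPt v' →
        (∀ e, e ≠ b' → Z e = V e) → Z b' = V b' * expPt v' →
        |R Z - R V - R W + R U| ≤ k b b' * (‖v‖ / θ) * (‖v'‖ / θ)) :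
    ∃ k : PBond P j → PBond P j → ℝ, (∀ b b', 0 ≤ k b b') ∧ (∀ b, ∑ b', k b b' * Real.exp (κ * (b.src.tdist b'.src : ℝ)) ≤ w') ∧
      ∀ (b b' : PBond P j) (v v' : Fin 3 → ℝ) (U V W Z : GaugeField P j (Matrix.specialUnitaryGroup (Fin 2) ℂ)),
        ‖v‖ ≤ r * θ → ‖v'‖ ≤ r * θ → PlaqSmall θ U → PlaqSmall θ V → PlaqSmall θ W → PlaqSmall θ Z →
        (∀ e, e ≠ b → V e = U e) → V b = U b * expPt v → (∀ e, e ≠ b' → W e = U e) → W b' = U b' * expPt v' →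
        (∀ e, e ≠ b' → Z e = V e) → Z b' = V b' * expPt v' →
        |R Z - R V - R W + R U| ≤ k b b' * (‖v‖ / θ) * (‖v'‖ / θ) := by
  obtain ⟨k, hk, hr', hc⟩ := h
  exact ⟨k, hk, fun b => (hr' b).trans hw, hc⟩

/-- (BLOCK) **CONSTANTS**: a configuration-independent function has the block with zero letters and any row mass `0 ≤ w`. [folklore] -/
theorem block_const (hw : 0 ≤ w) (c : ℝ) :
    ∃ k : PBond P j → PBond P j → ℝ, (∀ b b', 0 ≤ k b b') ∧ (∀ b, ∑ b', k b b' * Real.exp (κ * (b.src.tdist b'.src : ℝ)) ≤ w) ∧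
      ∀ (b b' : PBond P j) (v v' : Fin 3 → ℝ) (U V W Z : GaugeField P j (Matrix.specialUnitaryGroup (Fin 2) ℂ)),
        ‖v‖ ≤ r * θ → ‖v'‖ ≤ r * θ → PlaqSmall θ U → PlaqSmall θ V → PlaqSmall θ W → PlaqSmall θ Z →
        (∀ e, e ≠ b → V e = U e) → V b = U b * expPt v → (∀ e, e ≠ b' → W e = U e) → W b' = U b' * expPt v' →
        (∀ e, e ≠ b' → Z e = V e) → Z b' = V b' * expPt v' →
        |(fun _ => c) Z - (fun _ => c) V - (fun _ => c) W + (fun _ => c) U| ≤ k b b' * (‖v‖ / θ) * (‖v'‖ / θ) :=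
  ⟨fun _ _ => 0, fun _ _ => le_rfl, rowMass_zero_le hw, hClauseSq_const θ r c⟩

end Block

end Summit.QuantumFields.YangMills.Theorems.OrganTangentHClauseBlock

end
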